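import Literature.Claims.NS.Stanley2025
import Literature.Analysis.FunctionSpaces.TorusFourierModes
import Literature.Analysis.FunctionSpaces.TorusCalculusProofs
import Literature.Analysis.FluidPDE.TorusClassicalH1Balance
import Literature.Analysis.FluidPDE.TorusClassicalNSGalileanBoost
import HarnessLib

/-!
# C85 `Stanley2025` — kernel refutation of Proposition 2 Step 1 (`Step_P2S1`, p.27–28: «use Lemma 14
# to kill the convective and pressure terms … Hence X(t) ≤ X(0)») and of its field-level companion
# `Step_P2S1Abs`

Cell `ns-claims` (D-0090 NS-CLAIMS SWEEP), claim C85; typed skeleton `Literature.Claims.NS.Stanley2025`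
(p482596, typist-7 g2). Text of record: M. Stanley, *Uniform H¹ Control and Global Regularity for the
3-D Navier–Stokes Equations*, OSF Preprints 8hv92 v1 (2025) [Stanley2025], Proposition 2 (item 17)
p.27, proof Step 1: «Enstrophy balance. Take the L²-inner product of the Navier–Stokes equation with −Δu,
integrate over 𝕋³, and use Lemma 14 to kill the convective and pressure terms: ½ d/dt X(t) + ν‖Δu‖² = 0».

WHAT IS PROVED (vortex stretching does not integrate to zero on `𝕋³`, and the enstrophy of a
Navier–Stokes solution need not decrease):
* `convect_uW_apply`, `integral_inner_convect_laplacian_uW` — for the divergence-free trigonometric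
  field `uW(x) = −(0, sin 2πx₁, sin 2πx₂ + sin 2π(x₁+x₂))` on the unit torus (three Fourier modes
  `k1 = (1,0,0)`, `k2 = (0,1,0)`, `k3 = k1 + k2`, one resonant triad),
  `(uW·∇)uW = (0, 0, 2π sin 2πx₁ (cos 2πx₂ + cos 2π(x₁+x₂)))` and
  `∫_{𝕋³} ⟪(uW·∇)uW, ΔuW⟫ = 2π³`.
* `not_Step_P2S1Abs : ¬ Literature.Claims.NS.Stanley2025.Step_P2S1Abs` (field-level companion of
  Step 3, HYGIENE 13) — the killed convective pairing `∫⟪(u·∇)u, Δu⟫` is not zero for every smooth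
  divergence-free periodic field (it is the enstrophy-production term `−∫ Σ ∂ₘuᵢ ∂ₘu_k ∂ᵢu_k`, cf.
  `Torus.integral_inner_laplacian_convect_self_eq_neg`; it vanishes on `𝕋²`, for Beltrami fields and
  for single-mode-per-component fields, not in general).
* `not_Step_P2S1 : ¬ Literature.Claims.NS.Stanley2025.Step_P2S1` (Step 3 at the SOLUTION grain — the
  binder `h3` of `claim_of_steps`): with `ν = π³/(‖ΔuW‖²_{L²} + 1)` and the classical solution from the
  datum `uW` given by the local theory on `𝕋³` (`Torus.exists_maximal_classicalNS_anyMean`,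
  Robinson–Rodrigo–Sadowski 2016), the true enstrophy balance
  (`Torus.IsClassicalNSSolutionOn.hasDerivWithinAt_half_gradNormSq`, Foias–Manley–Rosa–Temam 2001
  (A.55)) gives `(½X)′(0) = −ν‖ΔuW‖² + 2π³ ≥ π³ > 0`, so `X(t) > X(0)` for some `t` in the window,
  against the printed «X(t) ≤ X(0)» (`exists_gt_of_hasDerivWithinAt_pos`).
The field computation is done on the Fourier side: `Δ` is diagonal on real trigonometric polynomials
(`Torus.laplacian_realTrigPoly`), the pairing of an integrable field with a trigonometric polynomial is
read off finitely many Fourier coefficients (`Torus.integral_inner_realTrigPoly_of_integrable`), and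
the convective term of `uW` is an explicit eight-character sum (`Torus.mFourierCoeff_sum_mFourier_smul`).

The ORDER-OF-RECORD locator of the row (referee ns-claims-ref-1 g2, RETYPE.md v0) is Step 1 =
`Step_L14` = Lemma 14 p.26 (field-level companion `Step_L14Abs`, rev 2 p486662), whose log-weighted
pressure pairing is attacked separately; this file decides Step 3 (both grains). Closed terms; axioms
`propext`, `Classical.choice`, `Quot.sound`.

WHAT THIS IS NOT: not a claim about NS regularity or blow-up; not a claim about any author beyond the
typed locator.
-/

-- The summit's canonical theorem namespace repeats the summit name (single-conjunct summit).
set_option linter.dupNamespace false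

noncomputable section

open Set Function MeasureTheory Filter Topology
open scoped ContDiff RealInnerProductSpace InnerProductSpace ComplexConjugate

namespace Summit.NavierStokesRegularity.NavierStokesRegularity.Theorems.Stanley2025

open Literature.Analysis.FunctionSpaces Literature.Analysis.FunctionSpaces.Torus
open Literature.Analysis.FluidPDE Literature.Claims.NS.Stanley2025 UnitAddTorus

/-! ## The witness field -/

/-- The frequency `k1 = (1,0,0)`. -/
def k1 : Fin 3 → ℤ := ![1, 0, 0]

/-- The frequency `k2 = (0,1,0)`. -/
def k2 : Fin 3 → ℤ := ![0, 1, 0]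

/-- The resonant frequency `k3 = k1 + k2 = (1,1,0)`. -/
def k3 : Fin 3 → ℤ := ![1, 1, 0]

/-- The frequency set of the witness. -/
def S : Finset (Fin 3 → ℤ) := {k1, k2, k3}

/-- The complex basis vector `e_y` of `ℂ³`. -/
def Ey : EuclideanSpace ℂ (Fin 3) := EuclideanSpace.single 1 1

/-- The complex basis vector `e_z` of `ℂ³`. -/
def Ez : EuclideanSpace ℂ (Fin 3) := EuclideanSpace.single 2 1

/-- The real basis vector `e_z` of `ℝ³`. -/
def ez : E3 := EuclideanSpace.single 2 1

/-- Fourier coefficients of the witness: `i e_y` at `k1`, `i e_z` at `k2`, `k3`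
(`Re (e_k(x) i v) = −sin (2π k·x) v`). -/
def coef (k : Fin 3 → ℤ) : EuclideanSpace ℂ (Fin 3) :=
  if k = k1 then Complex.I • Ey else Complex.I • Ez

/-- **The witness** `uW(x) = −(0, sin 2πx₁, sin 2πx₂ + sin 2π(x₁+x₂))`, as a real trigonometric
polynomial on the unit torus (sign chosen so that its enstrophy production is positive). -/
def uW : T3 → E3 := realTrigPoly S coef

/-- `k2 ≠ k1`. -/
theorem k2_ne_k1 : k2 ≠ k1 := by decide

/-- `k3 ≠ k1`. -/
theorem k3_ne_k1 : k3 ≠ k1 := by decide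

/-- `k1 ∉ {k2, k3}`. -/
theorem k1_not_mem : k1 ∉ ({k2, k3} : Finset (Fin 3 → ℤ)) := by decide

/-- `k2 ∉ {k3}`. -/
theorem k2_not_mem : k2 ∉ ({k3} : Finset (Fin 3 → ℤ)) := by decide

/-- The witness is smooth. -/
theorem uW_smooth : Torus.IsSmooth uW := isSmooth_realTrigPoly S coef

/-- `coef k1 = i e_y`. -/
theorem coef_k1 : coef k1 = Complex.I • Ey := by rw [coef, if_pos rfl]

/-- `coef k2 = i e_z`. -/
theorem coef_k2 : coef k2 = Complex.I • Ez := by rw [coef, if_neg k2_ne_k1]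

/-- `coef k3 = i e_z`. -/
theorem coef_k3 : coef k3 = Complex.I • Ez := by rw [coef, if_neg k3_ne_k1]

/-- Coordinates of the witness as real parts of three characters. -/
theorem uW_apply_coord (x : T3) (i : Fin 3) :
    uW x i = (mFourier k1 x * coef k1 i + (mFourier k2 x * coef k2 i + mFourier k3 x * coef k3 i)).re := by
  rw [uW, realTrigPoly_apply_coord, trigPoly_apply_coord, S, Finset.sum_insert k1_not_mem,
    Finset.sum_insert k2_not_mem, Finset.sum_singleton]

/-- Coordinates of the partial derivatives of the witness. -/
theorem partialDeriv_uW_apply_coord (x : T3) (j i : Fin 3) :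
    partialDeriv j uW x i =
      (mFourier k1 x * ((2 * Real.pi * Complex.I * (k1 j)) • coef k1) i +
        (mFourier k2 x * ((2 * Real.pi * Complex.I * (k2 j)) • coef k2) i +
          mFourier k3 x * ((2 * Real.pi * Complex.I * (k3 j)) • coef k3) i)).re := by
  rw [uW, partialDeriv_realTrigPoly, realTrigPoly_apply_coord, trigPoly_apply_coord, S,
    Finset.sum_insert k1_not_mem, Finset.sum_insert k2_not_mem, Finset.sum_singleton]

/-- The coefficients are transversal (`k · coef k = 0` on `S`). -/
theorem coef_transversal : IsTransversal S coef := by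
  intro k hk
  simp only [S, Finset.mem_insert, Finset.mem_singleton] at hk
  rcases hk with rfl | rfl | rfl
  · rw [coef_k1]; simp [Ey, k1]
  · rw [coef_k2]; simp [Ez, k2]
  · rw [coef_k3]; simp [Ez, k3]

/-- The witness is divergence free. -/
theorem uW_divFree : Torus.IsDivFree uW := isDivFree_realTrigPoly coef_transversal

/-- **The convective term of the witness** (quadratic, hence blind to the sign of `uW`):
`(uW·∇)uW (x) = sin 2πx₁ · 2π (cos 2πx₂ + cos 2π(x₁+x₂)) e_z`. -/
theorem convect_uW_apply (x : T3) :
    Torus.convect uW uW x =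
      ((mFourier k1 x).im * (2 * Real.pi * ((mFourier k2 x).re + (mFourier k3 x).re))) • ez := by
  unfold Torus.convect
  rw [fderiv_apply_eq_sum_partialDeriv (uW_smooth.isContDiff (by simp))]
  ext i
  simp only [Fin.sum_univ_three, PiLp.add_apply, PiLp.smul_apply, smul_eq_mul, uW_apply_coord,
    partialDeriv_uW_apply_coord, coef_k1, coef_k2, coef_k3]
  fin_cases i <;>
    simp [-mul_eq_mul_left_iff, -mul_eq_mul_right_iff, Ey, Ez, ez, k1, k2, k3,
      Complex.mul_re, Complex.mul_im, Complex.I_re, Complex.I_im]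
  ring

/-- Complexification of a multiple of `e_z`. -/
theorem complexify_smul_ez (r : ℝ) : EuclideanSpace.complexify (r • ez) = (r : ℂ) • Ez := by
  ext i
  fin_cases i <;> simp [EuclideanSpace.complexify_apply, ez, Ez]

/-- The eight characters of the convective term: `±k1 ± k2`, `±k1 ± k3`. -/
def nn : Fin 8 → (Fin 3 → ℤ) :=
  ![k1 + k2, k1 - k2, -k1 + k2, -k1 - k2, k1 + k3, k1 - k3, -k1 + k3, -k1 - k3]

/-- Their signs (`sin a cos b = (e^{ia} − e^{−ia})(e^{ib} + e^{−ib})/(4i)`). -/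
def sg : Fin 8 → ℂ := ![1, 1, -1, -1, 1, 1, -1, -1]

/-- Their vector coefficients `sg j · (−πi/2) e_z`. -/
def vv (j : Fin 8) : EuclideanSpace ℂ (Fin 3) := (sg j * (-(Real.pi * Complex.I) / 2)) • Ez

/-- **The convective term of the witness as a character sum.** -/
theorem complexify_convect_uW :
    (EuclideanSpace.complexify ∘ Torus.convect uW uW) = fun x => ∑ j : Fin 8, mFourier (nn j) x • vv j := by
  funext x
  simp only [comp_apply]
  rw [convect_uW_apply, complexify_smul_ez]
  simp only [Fin.sum_univ_succ, Fin.sum_univ_zero, nn, sg, vv, Matrix.cons_val_zero,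
    Matrix.cons_val_succ, sub_eq_add_neg, mFourier_add, mFourier_neg, smul_smul, add_zero,
    ← add_smul]
  congr 1
  set z1 := mFourier k1 x
  set z2 := mFourier k2 x
  set z3 := mFourier k3 x
  apply Complex.ext
  · simp [Complex.mul_re, Complex.mul_im, Complex.I_re, Complex.I_im, Complex.conj_re,
      Complex.conj_im]
    ring
  · simp [Complex.mul_re, Complex.mul_im, Complex.I_re, Complex.I_im, Complex.conj_re,
      Complex.conj_im]

/-- Fourier coefficients of the convective term. -/
theorem mFourierCoeff_convect_uW (k : Fin 3 → ℤ) :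
    mFourierCoeff (EuclideanSpace.complexify ∘ Torus.convect uW uW) k =
      ∑ j : Fin 8, if nn j = k then vv j else 0 := by
  rw [complexify_convect_uW]
  exact mFourierCoeff_sum_mFourier_smul _ _ _ _

/-- `𝓕[(uW·∇)uW](k1) = 0`. -/
theorem mFourierCoeff_convect_uW_k1 :
    mFourierCoeff (EuclideanSpace.complexify ∘ Torus.convect uW uW) k1 = 0 := by
  rw [mFourierCoeff_convect_uW]
  simp [Fin.sum_univ_succ, nn, vv, sg, k1, k2, k3]

/-- `𝓕[(uW·∇)uW](k2) = (πi/2) e_z` (from `−k1 + k3 = k2`). -/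
theorem mFourierCoeff_convect_uW_k2 :
    mFourierCoeff (EuclideanSpace.complexify ∘ Torus.convect uW uW) k2 =
      ((Real.pi * Complex.I) / 2) • Ez := by
  rw [mFourierCoeff_convect_uW]
  simp [Fin.sum_univ_succ, nn, vv, sg, k1, k2, k3]
  rw [← neg_smul]
  congr 1
  ring

/-- `𝓕[(uW·∇)uW](k3) = −(πi/2) e_z` (from `k1 + k2 = k3`). -/
theorem mFourierCoeff_convect_uW_k3 :
    mFourierCoeff (EuclideanSpace.complexify ∘ Torus.convect uW uW) k3 =
      (-(Real.pi * Complex.I) / 2) • Ez := by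
  rw [mFourierCoeff_convect_uW]
  simp [Fin.sum_univ_succ, nn, vv, sg, k1, k2, k3]

/-- The Laplacian coefficients of the witness. -/
def coefLap (k : Fin 3 → ℤ) : EuclideanSpace ℂ (Fin 3) :=
  -(((4 * Real.pi ^ 2 * freqNormSq k : ℝ) : ℂ) • coef k)

/-- `Δ uW = realTrigPoly S coefLap`. -/
theorem laplacian_uW (x : T3) : Torus.laplacian uW x = realTrigPoly S coefLap x :=
  laplacian_realTrigPoly S coef x

/-- `|k1|² = 1`. -/
theorem freqNormSq_k1 : freqNormSq k1 = 1 := by simp [freqNormSq, k1, Fin.sum_univ_three]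

/-- `|k2|² = 1`. -/
theorem freqNormSq_k2 : freqNormSq k2 = 1 := by simp [freqNormSq, k2, Fin.sum_univ_three]

/-- `|k3|² = 2`. -/
theorem freqNormSq_k3 : freqNormSq k3 = 2 := by
  simp [freqNormSq, k3, Fin.sum_univ_three]; norm_num

/-- **The enstrophy-production integral of the witness**: `∫_{𝕋³} ⟪(uW·∇)uW, ΔuW⟫ = 2π³`. -/
theorem integral_inner_convect_laplacian_uW :
    ∫ x, ⟪Torus.convect uW uW x, Torus.laplacian uW x⟫ = 2 * Real.pi ^ 3 := by
  simp_rw [laplacian_uW]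
  have hw : Integrable (Torus.convect uW uW) volume :=
    (uW_smooth.convect uW_smooth).continuous.integrable_unitAddTorus
  rw [integral_inner_realTrigPoly_of_integrable S coefLap hw, S, Finset.sum_insert k1_not_mem,
    Finset.sum_insert k2_not_mem, Finset.sum_singleton, mFourierCoeff_convect_uW_k1,
    mFourierCoeff_convect_uW_k2, mFourierCoeff_convect_uW_k3]
  have hre : ((Real.pi : ℂ) ^ 2).re = Real.pi ^ 2 := by rw [← Complex.ofReal_pow, Complex.ofReal_re]
  have him : ((Real.pi : ℂ) ^ 2).im = 0 := by rw [← Complex.ofReal_pow, Complex.ofReal_im]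
  simp [coefLap, coef_k1, coef_k2, coef_k3, freqNormSq_k1, freqNormSq_k2, freqNormSq_k3, Ey, Ez,
    inner_smul_left, inner_smul_right, Complex.mul_re, Complex.mul_im,
    Complex.I_re, Complex.I_im, Complex.conj_re, Complex.conj_im, Complex.div_re, Complex.div_im,
    hre, him]
  ring

/-! ## The refutation -/

/-- **`¬ Step 3 (field-level companion)`** — the convective pairing with `−Δu` does not vanish for
every smooth divergence-free periodic field: for `uW` it equals `2π³`.
[cite: Stanley2025, Proposition 2 Step 1 p.27] -/
theorem not_Step_P2S1Abs : ¬ Literature.Claims.NS.Stanley2025.Step_P2S1Abs := by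
  intro h
  have h0 := h uW uW_smooth uW_divFree
  rw [integral_inner_convect_laplacian_uW] at h0
  have hpi : (0 : ℝ) < Real.pi ^ 3 := by positivity
  linarith

/-! ## Step 3 at the solution grain: the enstrophy is not non-increasing -/

/-- A real function with positive one-sided derivative at the left end of `[0, τ]` exceeds its
initial value somewhere in `[0, τ]`. -/
theorem exists_gt_of_hasDerivWithinAt_pos {f : ℝ → ℝ} {D τ : ℝ} (hτ : 0 < τ)
    (hf : HasDerivWithinAt f D (Icc 0 τ) 0) (hD : 0 < D) : ∃ t ∈ Icc 0 τ, f 0 < f t := by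
  rw [hasDerivWithinAt_iff_tendsto_slope] at hf
  have hev : ∀ᶠ t in 𝓝[Icc 0 τ \ {0}] 0, 0 < slope f 0 t := hf.eventually (lt_mem_nhds hD)
  have hmem : ∀ᶠ t in 𝓝[Icc 0 τ \ {0}] 0, t ∈ Icc 0 τ \ {0} := eventually_mem_nhdsWithin
  haveI : (𝓝[Icc 0 τ \ {0}] (0 : ℝ)).NeBot := by
    rw [← mem_closure_iff_nhdsWithin_neBot, Icc_sdiff_left, closure_Ioc hτ.ne]
    exact ⟨le_rfl, hτ.le⟩
  obtain ⟨t, ht, htm⟩ := (hev.and hmem).exists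
  have ht0 : 0 < t := lt_of_le_of_ne htm.1.1 (Ne.symm htm.2)
  refine ⟨t, htm.1, ?_⟩
  rw [slope_def_field, sub_zero] at ht
  have h2 : 0 < f t - f 0 := by
    rcases div_pos_iff.mp ht with ⟨h, -⟩ | ⟨-, h⟩
    · exact h
    · exact absurd h (not_lt.mpr ht0.le)
  linarith

/-- **`¬ Step 3` at the solution grain** (the binder `h3 : Step_P2S1` of `claim_of_steps`): the printed
enstrophy balance «½ d/dt X + ν‖Δu‖² = 0, hence X(t) ≤ X(0)» fails along an actual Navier–Stokes
solution on `𝕋³`. Take the datum `uW` and `ν = π³/(‖ΔuW‖²_{L²} + 1)`; by the local theory on the torus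
(`Torus.exists_maximal_classicalNS_anyMean`, Robinson–Rodrigo–Sadowski 2016 §6.3/§8.1) there is a
classical solution on some `[0, τ]`, and the true balance
(`Torus.IsClassicalNSSolutionOn.hasDerivWithinAt_half_gradNormSq`, Foias–Manley–Rosa–Temam 2001
(A.55)) gives `(½X)′(0) = −ν‖ΔuW‖² + ∫⟪(uW·∇)uW, ΔuW⟫ ≥ −π³ + 2π³ > 0`, so `X` exceeds `X(0)` at some
`t ∈ [0, τ]`, whereas Step 3 forces `X(t) = X(0) − 2ν∫₀ᵗ‖Δu‖² ≤ X(0)`.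
[cite: Stanley2025, Proposition 2 Step 1 p.27–28] -/
theorem not_Step_P2S1 : ¬ Literature.Claims.NS.Stanley2025.Step_P2S1 := by
  intro h
  have hInn : 0 ≤ ∫ x, ‖Torus.laplacian uW x‖ ^ 2 := integral_nonneg fun _ => sq_nonneg _
  have hπ : 0 < Real.pi ^ 3 := by positivity
  obtain ⟨ν, hν⟩ : ∃ ν : ℝ, ν = Real.pi ^ 3 / ((∫ x, ‖Torus.laplacian uW x‖ ^ 2) + 1) := ⟨_, rfl⟩
  have hνpos : 0 < ν := by rw [hν]; positivity
  have hνL : ν * ∫ x, ‖Torus.laplacian uW x‖ ^ 2 ≤ Real.pi ^ 3 := by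
    rw [hν, div_mul_eq_mul_div, div_le_iff₀ (by linarith)]
    nlinarith
  obtain ⟨u, p, hu0, hcases⟩ :=
    Torus.exists_maximal_classicalNS_anyMean (d := Fin 3) (Fintype.card_fin 3) hνpos uW_smooth
      uW_divFree
  -- a closed window `[0, τ]` on which `(u, p)` is classical
  obtain ⟨τ, hτ, hsol⟩ : ∃ τ, 0 < τ ∧ Torus.IsClassicalNSSolutionOn (Icc 0 τ) ν 0 u p := by
    rcases hcases with ⟨hglob, -⟩ | ⟨T, hT, hloc, -, -⟩
    · exact ⟨1, one_pos, hglob.mono Icc_subset_Ici_self (uniqueDiffOn_Icc one_pos)⟩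
    · exact ⟨T / 2, by positivity,
        hloc.mono (Icc_subset_Ico_right (by linarith)) (uniqueDiffOn_Icc (by positivity))⟩
  -- Step 3 ⇒ `X(u t) ≤ X(u 0)` on the window
  have hle : ∀ t ∈ Icc 0 τ, Torus.gradNormSq (u t) ≤ Torus.gradNormSq (u 0) := by
    intro t ht
    have hid := h ν τ u p hνpos hτ hsol t ht
    have hnn : 0 ≤ ∫ s in (0 : ℝ)..t, lapNormSq (u s) :=
      intervalIntegral.integral_nonneg ht.1 fun s _ => integral_nonneg fun _ => sq_nonneg _
    simp only [Xgrad] at hid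
    nlinarith [hνpos.le]
  -- the true balance at `t = 0`
  have hD := hsol.hasDerivWithinAt_half_gradNormSq hτ (t := 0) ⟨le_rfl, hτ.le⟩
  simp only [hu0, Pi.zero_apply, sub_zero, integral_inner_convect_laplacian_uW] at hD
  obtain ⟨t, ht, hlt⟩ := exists_gt_of_hasDerivWithinAt_pos hτ hD (by linarith)
  simp only [hu0] at hlt
  have := hle t ht
  rw [hu0] at this
  linarith

end Summit.NavierStokesRegularity.NavierStokesRegularity.Theorems.Stanley2025

end
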